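import Mathlib
import HarnessLib
import Literature.Probability.LatticeModels.LatticeBootstrapFeasible
import Literature.Probability.LatticeModels.IsingDecoration
import Literature.Probability.LatticeModels.GriffithsMonotonicity
import Literature.Probability.LatticeModels.FreeBoundaryReflectionPositivity

/-!
# Route `LatticeSDPCertificates`, crux `CertifiedWindow` (stmt-CriticalPhenomena-5504):
# the one-site heat-bath (spin-flip / Schwinger–Dyson) rows of a boundary-law functional

Registered stub `stub_heatBathRows` of the rev-4 skeleton of the crux (line `registered`).
For the level-`L` boundary-law functional `E = boundaryLawFunctional d L β ν`
(`A ↦ ∫ ⟨σ_A⟩^η_{Λ_L;β,0} dν(η)`, `Λ_L = box d L`), every site `x ∈ Λ_L`, every sign pattern `τ`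
and every finite `B ∌ x`, with `N(x)` the neighbours of `x` and `τ_S = ∏_{y ∈ S} τ_y`:

`Σ_{S ⊆ N(x)} τ_S E({x} ∪ (B ∆ S)) = tanh(β Σ_{y ∈ N(x)} τ_y) · Σ_{S ⊆ N(x)} τ_S E(B ∆ S)`.

Proof: for a FIXED boundary condition `η` this is the one-site heat-bath (DLR) identity
`⟨σ_x g⟩ = ⟨tanh(β Σ_{y∼x} σ_y) g⟩` (`isingExpect_spinAt_mul_eq_tanh`, Friedli–Velenik 2017,
Lemma 6.7) tested against `g = σ_B ∏_{y ∼ x}(1 + τ_y σ_y) = Σ_{S ⊆ N(x)} τ_S σ_{B ∆ S}`, which does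
not read `σ_x`; on the support of `∏_{y∼x}(1 + τ_y σ_y)` one has `σ_y = τ_y` for all `y ∼ x`, so the
`tanh` factor is the constant `tanh(β Σ_{y∼x} τ_y)`. Then integrate `dν(η)` (finite sums of bounded
measurable integrands). These are the "spin-flip" equality rows of the lattice Ising bootstrap
(Cho–Sun 2023, Def. 11) satisfied by every Gibbs-inside functional.

Helper file (`--supports stmt-CriticalPhenomena-5504`); it proves the registered stub signature
verbatim (`stub_heatBathRows`, `d = 3`, `β = β_c(3)`) from the general-`d`, general-`β` version
`boundaryLawFunctional_heatBath_rows`.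
-/

noncomputable section

namespace Summit.CriticalPhenomena.Ising3DConformalLimit.Theorems

open Literature.Probability.LatticeModels MeasureTheory Finset
open scoped symmDiff

/-! ### Pointwise spin algebra -/

section SpinAlgebra

variable {V : Type*}

/-- `∏_{y ∈ N} (1 + τ_y σ_y) = Σ_{S ⊆ N} τ_S σ_S` (expand the product). [folklore] -/
theorem prod_one_add_spinAt_mul_eq_sum (N : Finset V) (τ σ : SpinConfig V) :
    ∏ y ∈ N, (1 + spinAt y τ * spinAt y σ) =
      ∑ S ∈ N.powerset, spinProduct S τ * spinProduct S σ := by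
  rw [Finset.prod_one_add]
  refine Finset.sum_congr rfl fun S _ => ?_
  rw [spinProduct, spinProduct, ← Finset.prod_mul_distrib]

/-- On the support of `∏_{y ∈ N} (1 + τ_y σ_y)` the spins `σ_y`, `y ∈ N`, coincide with `τ_y`, so
`tanh(β Σ_{y∈N} σ_y) ∏ (1 + τ_y σ_y) = tanh(β Σ_{y∈N} τ_y) ∏ (1 + τ_y σ_y)`. [folklore] -/
theorem tanh_mul_prod_one_add_eq (β : ℝ) (N : Finset V) (τ σ : SpinConfig V) :
    Real.tanh (β * ∑ y ∈ N, spinAt y σ) * ∏ y ∈ N, (1 + spinAt y τ * spinAt y σ) =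
      Real.tanh (β * ∑ y ∈ N, spinAt y τ) * ∏ y ∈ N, (1 + spinAt y τ * spinAt y σ) := by
  by_cases h : ∏ y ∈ N, (1 + spinAt y τ * spinAt y σ) = 0
  · rw [h, mul_zero, mul_zero]
  · have hsum : ∑ y ∈ N, spinAt y σ = ∑ y ∈ N, spinAt y τ := by
      refine Finset.sum_congr rfl fun y hy => ?_
      have hy0 : 1 + spinAt y τ * spinAt y σ ≠ 0 := fun h0 => h (Finset.prod_eq_zero hy h0)
      rcases spinAt_eq_one_or_eq_neg_one y τ with hτ | hτ <;>
        rcases spinAt_eq_one_or_eq_neg_one y σ with hσ | hσ <;>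
        first
          | exact hσ.trans hτ.symm
          | exact absurd (by rw [hσ, hτ]; norm_num) hy0
    rw [hsum]

variable [DecidableEq V]

/-- A spin product over a set avoiding `x` does not read the spin at `x`. [folklore] -/
theorem spinProduct_update_of_notMem {A : Finset V} {x : V} (hx : x ∉ A) (σ : SpinConfig V)
    (u : ℤˣ) : spinProduct A (Function.update σ x u) = spinProduct A σ := by
  unfold spinProduct
  refine Finset.prod_congr rfl fun y hy => ?_
  have hyx : y ≠ x := fun h => hx (h ▸ hy)
  simp [spinAt, Function.update_of_ne hyx]

/-- `σ_x σ_A = σ_{insert x A}` for `x ∉ A`. [folklore] -/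
theorem spinAt_mul_spinProduct_of_notMem {A : Finset V} {x : V} (hx : x ∉ A) (σ : SpinConfig V) :
    spinAt x σ * spinProduct A σ = spinProduct (insert x A) σ := by
  rw [spinProduct, spinProduct, Finset.prod_insert hx]

end SpinAlgebra

/-! ### The heat-bath rows in finite volume (fixed boundary condition) -/

section FiniteVolume

variable {V : Type*} (G : SimpleGraph V) [DecidableEq V] [G.LocallyFinite]

/-- **Heat-bath rows in finite volume.** For `x ∈ Λ`, a fixed boundary condition `η`, a sign
pattern `τ` and a finite `B ∌ x`:
`Σ_{S ⊆ N(x)} τ_S ⟨σ_{insert x (B ∆ S)}⟩^η_Λ = tanh(β Σ_{y∼x} τ_y) Σ_{S ⊆ N(x)} τ_S ⟨σ_{B ∆ S}⟩^η_Λ`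
— the one-site DLR identity `⟨σ_x g⟩ = ⟨tanh(β Σ_{y∼x} σ_y) g⟩` (Friedli–Velenik 2017, Lemma 6.7)
tested against `g = σ_B ∏_{y∼x}(1 + τ_y σ_y)`; the spin-flip equalities of Cho–Sun 2023, Def. 11.
[cite: FriedliVelenik2017, Lemma 6.7, eq. (6.5)] -/
theorem isingCorr_fixed_heatBath_rows {Λ : Finset V} {x : V} (hx : x ∈ Λ) (β : ℝ)
    (η τ : SpinConfig V) {B : Finset V} (hxB : x ∉ B) :
    ∑ S ∈ (G.neighborFinset x).powerset,
        spinProduct S τ * isingCorr G Λ β 0 (.fixed η) (insert x (B ∆ S)) =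
      Real.tanh (β * ∑ y ∈ G.neighborFinset x, spinAt y τ) *
        ∑ S ∈ (G.neighborFinset x).powerset,
          spinProduct S τ * isingCorr G Λ β 0 (.fixed η) (B ∆ S) := by
  set N := G.neighborFinset x with hN
  have hxN : x ∉ N := fun h => ((SimpleGraph.mem_neighborFinset G x x).1 h).ne rfl
  have hxBS : ∀ S ∈ N.powerset, x ∉ B ∆ S := fun S hS h => by
    rw [Finset.mem_symmDiff] at h
    rcases h with ⟨h1, _⟩ | ⟨h2, _⟩
    · exact hxB h1
    · exact hxN (Finset.mem_powerset.1 hS h2)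
  -- the test observable `g = Σ_S τ_S σ_{B ∆ S} = σ_B ∏_{y ∼ x} (1 + τ_y σ_y)`
  set g : SpinConfig V → ℝ := fun σ => ∑ S ∈ N.powerset, spinProduct S τ * spinProduct (B ∆ S) σ
    with hg
  have hg_eq : ∀ σ, g σ = spinProduct B σ * ∏ y ∈ N, (1 + spinAt y τ * spinAt y σ) := by
    intro σ
    rw [prod_one_add_spinAt_mul_eq_sum, Finset.mul_sum]
    refine Finset.sum_congr rfl fun S _ => ?_
    rw [← spinProduct_mul_spinProduct B S σ]
    ring
  have hgm : Measurable g :=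
    Finset.measurable_sum _ fun S _ => (measurable_spinProduct _).const_mul _
  have hg_upd : ∀ (σ : SpinConfig V) (u : ℤˣ), g (Function.update σ x u) = g σ := by
    intro σ u
    simp only [hg]
    refine Finset.sum_congr rfl fun S hS => ?_
    rw [spinProduct_update_of_notMem (hxBS S hS)]
  have key := isingExpect_spinAt_mul_eq_tanh G hx β η hgm hg_upd
  -- left-hand side: `⟨σ_x g⟩ = Σ_S τ_S ⟨σ_{insert x (B ∆ S)}⟩`
  have hL : isingExpect G Λ β 0 (.fixed η) (fun σ => spinAt x σ * g σ) =
      ∑ S ∈ N.powerset, spinProduct S τ * isingCorr G Λ β 0 (.fixed η) (insert x (B ∆ S)) := by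
    have hfun : (fun σ => spinAt x σ * g σ) =
        fun σ => ∑ S ∈ N.powerset, spinProduct S τ * spinProduct (insert x (B ∆ S)) σ := by
      funext σ
      simp only [hg, Finset.mul_sum]
      refine Finset.sum_congr rfl fun S hS => ?_
      rw [← spinAt_mul_spinProduct_of_notMem (hxBS S hS)]
      ring
    rw [hfun]
    exact isingExpect_sum_mul_spinProduct G N.powerset (fun S => spinProduct S τ)
      (fun S => insert x (B ∆ S)) Λ β 0 (.fixed η)
  -- right-hand side: the `tanh` factor is constant on the support of `g`
  have hR : isingExpect G Λ β 0 (.fixed η)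
        (fun σ => Real.tanh (β * ∑ y ∈ N, spinAt y σ) * g σ) =
      Real.tanh (β * ∑ y ∈ N, spinAt y τ) *
        ∑ S ∈ N.powerset, spinProduct S τ * isingCorr G Λ β 0 (.fixed η) (B ∆ S) := by
    have hfun : (fun σ => Real.tanh (β * ∑ y ∈ N, spinAt y σ) * g σ) =
        fun σ => Real.tanh (β * ∑ y ∈ N, spinAt y τ) * g σ := by
      funext σ
      rw [hg_eq, mul_left_comm, tanh_mul_prod_one_add_eq β N τ σ]
      ring
    rw [hfun, isingExpect_const_mul' G Λ 0 _ β _ hgm]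
    congr 1
    exact isingExpect_sum_mul_spinProduct G N.powerset (fun S => spinProduct S τ)
      (fun S => B ∆ S) Λ β 0 (.fixed η)
  rw [← hL, key, hR]

end FiniteVolume

/-! ### The heat-bath rows of a boundary-law functional -/

section BoundaryLaw

variable {d : ℕ}

/-- **Heat-bath (spin-flip) rows of a boundary-law functional.** For every level `L`, inverse
temperature `β`, probability boundary law `ν`, site `x ∈ Λ_L = box d L`, sign pattern `τ` and
finite `B ∌ x`, the functional `E = boundaryLawFunctional d L β ν` satisfies
`Σ_{S ⊆ N(x)} τ_S E(insert x (B ∆ S)) = tanh(β Σ_{y∼x} τ_y) Σ_{S ⊆ N(x)} τ_S E(B ∆ S)`: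
the fixed-boundary-condition identity `isingCorr_fixed_heatBath_rows` integrated `dν(η)`
(Friedli–Velenik 2017, Lemma 6.7 with §6.2 eq. (6.12); Cho–Sun 2023, Def. 11, spin-flip rows).
[cite: FriedliVelenik2017, Lemma 6.7, eq. (6.5)] -/
theorem boundaryLawFunctional_heatBath_rows (L : ℕ) (β : ℝ) (ν : Measure (SpinConfig (Site d)))
    [IsProbabilityMeasure ν] {x : Site d} (hx : x ∈ box d L) (τ : SpinConfig (Site d))
    {B : Finset (Site d)} (hxB : x ∉ B) :
    ∑ S ∈ ((zdGraph d).neighborFinset x).powerset,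
        spinProduct S τ * boundaryLawFunctional d L β ν (insert x (B ∆ S)) =
      Real.tanh (β * ∑ y ∈ (zdGraph d).neighborFinset x, spinAt y τ) *
        ∑ S ∈ ((zdGraph d).neighborFinset x).powerset,
          spinProduct S τ * boundaryLawFunctional d L β ν (B ∆ S) := by
  set N := (zdGraph d).neighborFinset x with hN
  have hint : ∀ A : Finset (Site d),
      Integrable (fun η : SpinConfig (Site d) => isingCorr (zdGraph d) (box d L) β 0 (.fixed η) A) ν :=
    fun A => Integrable.of_bound (measurable_isingCorr_fixed_box L β A).aestronglyMeasurable 1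
      (Filter.Eventually.of_forall fun η => by
        rw [Real.norm_eq_abs]; exact abs_isingCorr_le_one (zdGraph d) (box d L) β 0 _ A)
  simp only [boundaryLawFunctional_apply]
  calc ∑ S ∈ N.powerset, spinProduct S τ *
          ∫ η, isingCorr (zdGraph d) (box d L) β 0 (.fixed η) (insert x (B ∆ S)) ∂ν
      = ∫ η, ∑ S ∈ N.powerset, spinProduct S τ *
          isingCorr (zdGraph d) (box d L) β 0 (.fixed η) (insert x (B ∆ S)) ∂ν := by
        rw [integral_finsetSum _ fun S _ => (hint _).const_mul _]
        refine Finset.sum_congr rfl fun S _ => ?_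
        exact (integral_const_mul _ _).symm
    _ = ∫ η, Real.tanh (β * ∑ y ∈ N, spinAt y τ) * ∑ S ∈ N.powerset, spinProduct S τ *
          isingCorr (zdGraph d) (box d L) β 0 (.fixed η) (B ∆ S) ∂ν := by
        refine integral_congr_ae (Filter.Eventually.of_forall fun η => ?_)
        exact isingCorr_fixed_heatBath_rows (zdGraph d) hx β η τ hxB
    _ = Real.tanh (β * ∑ y ∈ N, spinAt y τ) * ∑ S ∈ N.powerset, spinProduct S τ *
          ∫ η, isingCorr (zdGraph d) (box d L) β 0 (.fixed η) (B ∆ S) ∂ν := by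
        rw [integral_const_mul, integral_finsetSum _ fun S _ => (hint _).const_mul _]
        congr 1
        refine Finset.sum_congr rfl fun S _ => ?_
        exact integral_const_mul _ _

end BoundaryLaw

/-- **Registered stub `stub_heatBathRows` of crux `CertifiedWindow` (stmt-CriticalPhenomena-5504),
rev-4 skeleton, line `registered`:** the one-site heat-bath / spin-flip rows of the level-`L`
boundary-law functional `boundaryLawFunctional 3 L β_c(3) ν` on `ℤ³`, verbatim
(`boundaryLawFunctional_heatBath_rows` at `d = 3`, `β = β_c(3)`; Friedli–Velenik 2017, Lemma 6.7;
Cho–Sun 2023, Def. 11). [cite: FriedliVelenik2017, Lemma 6.7, eq. (6.5)] -/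
theorem stub_heatBathRows : ∀ (L : ℕ) (ν : MeasureTheory.Measure (Literature.Probability.LatticeModels.SpinConfig (Literature.Probability.LatticeModels.Site 3))), MeasureTheory.IsProbabilityMeasure ν → ∀ x : Literature.Probability.LatticeModels.Site 3, x ∈ Literature.Probability.LatticeModels.box 3 L → ∀ (τ : Literature.Probability.LatticeModels.SpinConfig (Literature.Probability.LatticeModels.Site 3)) (B : Finset (Literature.Probability.LatticeModels.Site 3)), x ∉ B → ∑ S ∈ ((Literature.Probability.LatticeModels.zdGraph 3).neighborFinset x).powerset, Literature.Probability.LatticeModels.spinProduct S τ * Literature.Probability.LatticeModels.boundaryLawFunctional 3 L (Literature.Probability.LatticeModels.criticalBeta 3) ν (insert x (symmDiff B S)) = Real.tanh (Literature.Probability.LatticeModels.criticalBeta 3 * ∑ y ∈ (Literature.Probability.LatticeModels.zdGraph 3).neighborFinset x, Literature.Probability.LatticeModels.spinAt y τ) * ∑ S ∈ ((Literature.Probability.LatticeModels.zdGraph 3).neighborFinset x).powerset, Literature.Probability.LatticeModels.spinProduct S τ * Literature.Probability.LatticeModels.boundaryLawFunctional 3 L (Literature.Probability.LatticeModels.criticalBeta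 3) ν (symmDiff B S) :=
  fun L ν hν _x hx τ _B hxB =>
    haveI := hν
    boundaryLawFunctional_heatBath_rows L (criticalBeta 3) ν hx τ hxB

end Summit.CriticalPhenomena.Ising3DConformalLimit.Theorems

end
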